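import Mathlib.Analysis.Calculus.LogDerivUniformlyOn
import Mathlib.Analysis.Normed.Module.MultipliableUniformlyOn
import Mathlib.Analysis.SpecialFunctions.Log.Summable
import Literature.NumberTheory.LFunctions.NewmanProofs
import Literature.Analysis.Complex.HadamardGenusZeroProofs
import Literature.NumberTheory.LFunctions.DeBruijnNewmanUpperBound
import HarnessLib

/-!
# The Hadamard product of `H_t` and the partial-fraction series of `H_t'/H_t`

Trunk T-ANT (`Literature/NumberTheory/LFunctions`). Polymath 15 (Res. Math. Sci. 6 (2019), §3,
proof of Prop. 3.1): "as `H_t` is even, non-zero at the origin, and entire of order `1`, we see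
from the Hadamard factorization theorem that `H_t(z) = H_t(0) ∏'_k (1 − z/z_k)` ... so we may take
logarithmic derivatives and conclude that `H_t'/H_t (z) = ∑'_k 1/(z − z_k)`" (the primes: the
factors/terms for `z_k` and `−z_k` are grouped). This file proves this from the tree's Hadamard
factorisation in genus zero (`Literature.Analysis.Complex.hadamard_genus_zero_holds`, applied — as in
`NewmanProofs.lean` — to the even lift `G_t(w) = H_t(i√w)` of order `≤ 3/4`):

* `Literature.NumberTheory.LFunctions.exists_isHadamardSeq` — there is a sequence `b` with `∑ ‖b_n‖ < ∞` and
  `H_t(z)/H_t(0) = ∏_n (1 + b_n z²)` for all `z` (grouped Hadamard product; the zeros of `H_t` are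
  the `±ζ` with `ζ² = −1/b_n`, `b_n ≠ 0`); `IsHadamardSeq.conj`: so is `conj ∘ b`
  (`H_t(z̄) = conj H_t(z)`).
* `Literature.NumberTheory.LFunctions.IsHadamardSeq.logDeriv_eq` — `H_t'/H_t (z) = ∑_n 2 b_n z/(1 + b_n z²)` at every `z` with
  `H_t(z) ≠ 0` (Mathlib's `logDeriv_tprod_eq_tsum`).
* `Literature.NumberTheory.LFunctions.IsHadamardSeq.eq_pow_mul_cofactor`, `cofactor_self_ne_zero`, `analyticOrderAt_eq_mult`,
  `logDeriv_cofactor_self` — at a zero `z₁` of `H_t`: `H_t(w) = (w − z₁)^m Q(w)` with `Q` entire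
  (`cofactor`), `Q(z₁) ≠ 0`, `m = mult = #{n : 1 + b_n z₁² = 0}` is the analytic order of `z₁`, and
  the regularised logarithmic derivative is
  `Q'/Q (z₁) = m/(2 z₁) + ∑_n 2 b_n z₁/(1 + b_n z₁²)` (the terms with `1 + b_n z₁² = 0` read `0`).
* `Literature.NumberTheory.LFunctions.im_logDeriv_cofactor_lt` — **the sign computation of Polymath 15, proof of Prop. 3.3**:
  if `z₁ = x + iY` (`x, Y > 0`) is a zero of `H_t` of multiplicity `m`, all zeros of `H_t` have
  `|Im| < 1`, and every zero `ρ` with `|Im ρ| > Y` has `(x − Re ρ)² ≥ 1 − Y²`, then for every local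
  cofactor `Q` (`H_t = (w − z₁)^m Q` near `z₁`, `Q(z₁) ≠ 0`): `Im (Q'/Q)(z₁) < −m/(2Y)`.
  (Polymath 15 shows `Im ż_j = −2 ∑' (Y − y_k)/((x − x_k)² + (Y − y_k)²) < −1/Y` for a simple zero
  by exactly this bookkeeping: the conjugate zero `x − iY` contributes `−1/Y`, `−x − iY` contributes
  negatively, zeros
  with `|y_k| ≤ Y` contribute non-positively, and a zero with `y_k > Y` paired with its conjugate
  contributes non-positively iff `y_k² ≤ (x − x_k)² + Y²`.)

## References

* D. H. J. Polymath, *Effective approximation of heat flow evolution of the Riemann `ξ` function,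
  and a new upper bound for the de Bruijn–Newman constant*, Res. Math. Sci. 6 (2019), §3, proofs of
  Prop. 3.1 (i) and Prop. 3.3 (arXiv:1904.12438).
-/

noncomputable section

open Complex Filter Topology Metric

namespace Literature.NumberTheory.LFunctions

/-! ## Infinite products `∏ (1 + b_n z²)` with `∑ ‖b_n‖ < ∞` -/

section Products

variable {ι : Type*} {b : ι → ℂ}

/-- `‖b_n z²‖ ≤ ‖b_n‖ R²` on the ball `‖z‖ < R`. [folklore] -/
theorem norm_mul_sq_le_of_mem_ball {R : ℝ} (c : ℂ) {z : ℂ} (hz : z ∈ ball (0 : ℂ) R) :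
    ‖c * z ^ 2‖ ≤ ‖c‖ * R ^ 2 := by
  rw [norm_mul, norm_pow]
  have hz' : ‖z‖ < R := by simpa using hz
  gcongr

/-- `∏_n (1 + b_n z²)` converges locally uniformly on every ball. [folklore] -/
theorem multipliableLocallyUniformlyOn_one_add_mul_sq (hb : Summable fun n ↦ ‖b n‖) (R : ℝ) :
    MultipliableLocallyUniformlyOn (fun n z ↦ 1 + b n * z ^ 2) (ball (0 : ℂ) R) :=
  Summable.multipliableLocallyUniformlyOn_one_add isOpen_ball (hb.mul_right (R ^ 2))
    (Eventually.of_forall fun n z hz ↦ norm_mul_sq_le_of_mem_ball (b n) hz) fun n ↦ by fun_prop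

/-- The partial products converge locally uniformly on every ball to `∏' (1 + b_n z²)`.
[folklore] -/
theorem hasProdLocallyUniformlyOn_one_add_mul_sq (hb : Summable fun n ↦ ‖b n‖) (R : ℝ) :
    HasProdLocallyUniformlyOn (fun n z ↦ 1 + b n * z ^ 2) (fun z ↦ ∏' n, (1 + b n * z ^ 2))
      (ball (0 : ℂ) R) :=
  Summable.hasProdLocallyUniformlyOn_one_add isOpen_ball (hb.mul_right (R ^ 2))
    (Eventually.of_forall fun n z hz ↦ norm_mul_sq_le_of_mem_ball (b n) hz) fun n ↦ by fun_prop

/-- `z ↦ ∏' (1 + b_n z²)` is entire (locally uniform limit of polynomials). [folklore] -/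
theorem differentiable_tprod_one_add_mul_sq (hb : Summable fun n ↦ ‖b n‖) :
    Differentiable ℂ fun z ↦ ∏' n, (1 + b n * z ^ 2) := by
  intro z
  have hR : z ∈ ball (0 : ℂ) (‖z‖ + 1) := by simp
  have h := hasProdLocallyUniformlyOn_one_add_mul_sq hb (‖z‖ + 1)
  rw [hasProdLocallyUniformlyOn_iff_tendstoLocallyUniformlyOn] at h
  have hd : DifferentiableOn ℂ (fun z ↦ ∏' n, (1 + b n * z ^ 2)) (ball (0 : ℂ) (‖z‖ + 1)) :=
    h.differentiableOn (Eventually.of_forall fun s ↦ by fun_prop) isOpen_ball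
  exact hd.differentiableAt (isOpen_ball.mem_nhds hR)

/-- A product `∏' (1 + b_n z²)` all of whose factors are non-zero is non-zero
(`∑ log (1 + b_n z²)` converges). [folklore] -/
theorem tprod_one_add_mul_sq_ne_zero (hb : Summable fun n ↦ ‖b n‖) {z : ℂ}
    (hz : ∀ n, 1 + b n * z ^ 2 ≠ 0) : ∏' n, (1 + b n * z ^ 2) ≠ 0 := by
  have hs : Summable fun n ↦ b n * z ^ 2 := (Summable.of_norm hb).mul_right _
  rw [← Complex.cexp_tsum_eq_tprod hz (Complex.summable_log_one_add_of_summable hs)]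
  exact Complex.exp_ne_zero _

/-- `logDeriv (1 + b z²) = 2bz/(1 + bz²)` (both sides `0` where `1 + bz² = 0`). [folklore] -/
theorem logDeriv_one_add_mul_sq (c z : ℂ) :
    logDeriv (fun z ↦ 1 + c * z ^ 2) z = 2 * c * z / (1 + c * z ^ 2) := by
  rw [logDeriv_apply]
  have : deriv (fun z ↦ 1 + c * z ^ 2) z = 2 * c * z := by
    have h : HasDerivAt (fun z ↦ 1 + c * z ^ 2) (c * (2 * z)) z := by
      simpa using ((hasDerivAt_pow 2 z).const_mul c).const_add 1
    rw [h.deriv]; ring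
  rw [this]

/-- The partial-fraction terms `2 b_n z/(1 + b_n z²)` are absolutely summable. [folklore] -/
theorem summable_logDeriv_terms (hb : Summable fun n ↦ ‖b n‖) (z : ℂ) :
    Summable fun n ↦ 2 * b n * z / (1 + b n * z ^ 2) := by
  have hs : Summable fun n ↦ b n * z ^ 2 := (Summable.of_norm hb).mul_right _
  refine Summable.of_norm_bounded_eventually (g := fun n ↦ 4 * ‖z‖ * ‖b n‖)
    ((hb.mul_left (4 * ‖z‖))) ?_
  filter_upwards [hs.tendsto_cofinite_zero.eventually (Metric.ball_mem_nhds _ one_half_pos)]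
    with n hn
  have hn' : ‖b n * z ^ 2‖ < 1 / 2 := by simpa using hn
  have hden : 1 / 2 ≤ ‖1 + b n * z ^ 2‖ := by
    have := norm_sub_norm_le (1 : ℂ) (-(b n * z ^ 2))
    rw [sub_neg_eq_add, norm_neg, norm_one] at this
    linarith
  rw [norm_div, norm_mul, norm_mul, Complex.norm_two]
  rw [div_le_iff₀ (by linarith)]
  nlinarith [norm_nonneg (b n), norm_nonneg z, mul_nonneg (norm_nonneg (b n)) (norm_nonneg z)]

/-- **Logarithmic derivative of the product**: `(∏ (1 + b_n z²))'/∏(1 + b_n z²) =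
∑ 2 b_n z/(1 + b_n z²)` wherever no factor vanishes. [folklore] -/
theorem logDeriv_tprod_one_add_mul_sq (hb : Summable fun n ↦ ‖b n‖) {z : ℂ}
    (hz : ∀ n, 1 + b n * z ^ 2 ≠ 0) :
    logDeriv (fun w ↦ ∏' n, (1 + b n * w ^ 2)) z = ∑' n, 2 * b n * z / (1 + b n * z ^ 2) := by
  have hR : z ∈ ball (0 : ℂ) (‖z‖ + 1) := by simp
  have h := logDeriv_tprod_eq_tsum (f := fun n w ↦ 1 + b n * w ^ 2) isOpen_ball hR hz
    (fun n ↦ by fun_prop) ?_ (multipliableLocallyUniformlyOn_one_add_mul_sq hb _)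
    (tprod_one_add_mul_sq_ne_zero hb hz)
  · rw [h]
    exact tsum_congr fun n ↦ logDeriv_one_add_mul_sq (b n) z
  · simp only [logDeriv_one_add_mul_sq]
    exact summable_logDeriv_terms hb z

end Products

/-! ## The Hadamard product of `H_t` -/

/-- `G_t(−z²) = H_t(z)` for Newman's even lift `G_t(w) = H_t(i√w)`. [folklore] -/
theorem evenLift_neg_sq (t : ℝ) (z : ℂ) : Newman.evenLift t (-z ^ 2) = deBruijnH t z := by
  have h1 : -z ^ 2 = (-I * z) ^ 2 := by rw [mul_pow, neg_pow_two, I_sq]; ring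
  rw [h1, Newman.evenLift_sq]
  congr 1
  rw [← mul_assoc, mul_neg, I_mul_I, neg_neg, one_mul]

/-- `b` is a *Hadamard sequence* for `H_t`: `∑ ‖b_n‖ < ∞` and `H_t(z)/H_t(0) = ∏_n (1 + b_n z²)`
for every `z` (the grouped Hadamard product of Polymath 15, §3). [cite: Polymath2019, §3] -/
structure IsHadamardSeq (t : ℝ) (b : ℕ → ℂ) : Prop where
  summable : Summable fun n ↦ ‖b n‖
  hasProd : ∀ z : ℂ, HasProd (fun n ↦ 1 + b n * z ^ 2) (deBruijnH t z / deBruijnH t 0)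

/-- **Hadamard product of `H_t`** (genus zero in `z²`): there is a Hadamard sequence for `H_t`.
From `Literature.Analysis.Complex.hadamard_genus_zero_holds` applied to `G_t` (order `≤ 3/4 < 1`,
`Newman.norm_evenLift_le`) and `G_t(−z²) = H_t(z)`. [cite: Polymath2019, §3] -/
theorem exists_isHadamardSeq (t : ℝ) : ∃ b : ℕ → ℂ, IsHadamardSeq t b := by
  obtain ⟨K, -, hK⟩ := Newman.norm_evenLift_le t
  obtain ⟨b, hbs, hprod⟩ := Literature.Analysis.Complex.hadamard_genus_zero_holds (Newman.evenLift t) (3 / 4) K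
    (Newman.differentiable_evenLift t) (by norm_num) hK (Newman.evenLift_zero_ne_zero t)
  refine ⟨b, hbs, fun z ↦ ?_⟩
  have h := hprod (-z ^ 2)
  rw [evenLift_neg_sq, Newman.evenLift_zero] at h
  have e : (fun n ↦ 1 + b n * z ^ 2) = fun n ↦ 1 - b n * -z ^ 2 := funext fun n ↦ by ring
  rw [e]
  exact h

namespace IsHadamardSeq

variable {t : ℝ} {b : ℕ → ℂ}

/-- `H_t(0)` is fixed by conjugation. [folklore] -/
theorem conj_deBruijnH_zero (t : ℝ) : starRingEnd ℂ (deBruijnH t 0) = deBruijnH t 0 := by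
  have := deBruijnH_conj t 0
  rw [map_zero] at this
  exact this.symm

/-- The conjugate sequence is again a Hadamard sequence (`H_t(z̄) = conj H_t(z)`).
[cite: Polymath2019, §3] -/
theorem conj (h : IsHadamardSeq t b) : IsHadamardSeq t fun n ↦ starRingEnd ℂ (b n) where
  summable := by simpa only [Complex.norm_conj] using h.summable
  hasProd z := by
    have h1 := (h.hasProd (starRingEnd ℂ z)).map (starRingEnd ℂ) Complex.continuous_conj
    rw [map_div₀, deBruijnH_conj, Complex.conj_conj, conj_deBruijnH_zero] at h1
    have e : (⇑(starRingEnd ℂ) ∘ fun n ↦ 1 + b n * (starRingEnd ℂ) z ^ 2) =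
        fun n ↦ 1 + starRingEnd ℂ (b n) * z ^ 2 := by
      funext n
      simp only [Function.comp_apply, map_add, map_one, map_mul, map_pow, Complex.conj_conj]
    rw [e] at h1
    exact h1

/-- `H_t(z)/H_t(0) = ∏' (1 + b_n z²)`. [cite: Polymath2019, §3] -/
theorem tprod_eq (h : IsHadamardSeq t b) (z : ℂ) :
    ∏' n, (1 + b n * z ^ 2) = deBruijnH t z / deBruijnH t 0 :=
  (h.hasProd z).tprod_eq

/-- A vanishing factor forces `H_t(z) = 0`. [folklore] -/
theorem eq_zero_of_factor (h : IsHadamardSeq t b) {z : ℂ} {n : ℕ} (hn : 1 + b n * z ^ 2 = 0) :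
    deBruijnH t z = 0 := by
  have := Newman.eq_zero_of_hasProd_of_eq_zero (h.hasProd z) hn
  rcases div_eq_zero_iff.1 this with h0 | h0
  · exact h0
  · exact absurd h0 (deBruijnH_apply_zero_ne_zero t)

/-- Where `H_t ≠ 0`, no factor vanishes. [folklore] -/
theorem factor_ne_zero (h : IsHadamardSeq t b) {z : ℂ} (hz : deBruijnH t z ≠ 0) (n : ℕ) :
    1 + b n * z ^ 2 ≠ 0 := fun hn ↦ hz (h.eq_zero_of_factor hn)

/-- **The partial-fraction series of `H_t'/H_t`**: at every `z` with `H_t(z) ≠ 0`,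
`H_t'(z)/H_t(z) = ∑_n 2 b_n z/(1 + b_n z²)` (`= ∑'_k 1/(z − z_k)` grouped over `±z_k`).
[cite: Polymath2019, §3, proof of Prop. 3.1] -/
theorem logDeriv_eq (h : IsHadamardSeq t b) {z : ℂ} (hz : deBruijnH t z ≠ 0) :
    logDeriv (deBruijnH t) z = ∑' n, 2 * b n * z / (1 + b n * z ^ 2) := by
  rw [← logDeriv_tprod_one_add_mul_sq h.summable (h.factor_ne_zero hz)]
  have e : (fun w ↦ ∏' n, (1 + b n * w ^ 2)) = fun w ↦ (deBruijnH t 0)⁻¹ * deBruijnH t w := by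
    funext w; rw [h.tprod_eq, div_eq_inv_mul]
  rw [e, logDeriv_const_mul _ _ (inv_ne_zero (deBruijnH_apply_zero_ne_zero t))]

end IsHadamardSeq

/-! ## At a zero of `H_t`: multiplicity, cofactor, regularised logarithmic derivative -/

/-- A zero of `H_t` is not `0` (`H_t(0) > 0`). [folklore] -/
theorem ne_zero_of_deBruijnH_eq_zero {t : ℝ} {z₁ : ℂ} (hz₁ : deBruijnH t z₁ = 0) : z₁ ≠ 0 := by
  rintro rfl
  exact deBruijnH_apply_zero_ne_zero t hz₁

namespace IsHadamardSeq

variable {t : ℝ} {b : ℕ → ℂ}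

/-- Only finitely many factors `1 + b_n z₁²` vanish at a given point (`b_n → 0`). [folklore] -/
theorem finite_setOf_factor_eq_zero (h : IsHadamardSeq t b) (z₁ : ℂ) :
    {n : ℕ | 1 + b n * z₁ ^ 2 = 0}.Finite := by
  have ht : Tendsto (fun n ↦ b n * z₁ ^ 2) cofinite (𝓝 0) := by
    simpa using ((Summable.of_norm h.summable).tendsto_cofinite_zero).mul_const (z₁ ^ 2)
  have hev : ∀ᶠ n in cofinite, ‖b n * z₁ ^ 2‖ < 1 := by
    have := ht.norm
    rw [norm_zero] at this
    exact this.eventually (gt_mem_nhds one_pos)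
  have hne : ∀ᶠ n in cofinite, 1 + b n * z₁ ^ 2 ≠ 0 := hev.mono fun n hn h0 ↦ by
    have e : b n * z₁ ^ 2 = -1 := by linear_combination h0
    rw [e, norm_neg, norm_one] at hn
    exact lt_irrefl _ hn
  simpa [Filter.eventually_cofinite] using hne

/-- The (finite) set of indices `n` with `1 + b_n z₁² = 0`. [folklore] -/
def zeroIndices (h : IsHadamardSeq t b) (z₁ : ℂ) : Finset ℕ :=
  (h.finite_setOf_factor_eq_zero z₁).toFinset

/-- Membership in `zeroIndices`. [folklore] -/
theorem mem_zeroIndices (h : IsHadamardSeq t b) {z₁ : ℂ} {n : ℕ} :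
    n ∈ h.zeroIndices z₁ ↔ 1 + b n * z₁ ^ 2 = 0 := by
  simp [zeroIndices]

/-- The tail product over the factors not vanishing at `z₁`. [folklore] -/
def tailProd (h : IsHadamardSeq t b) (z₁ w : ℂ) : ℂ :=
  ∏' n : ↥((h.zeroIndices z₁ : Set ℕ)ᶜ), (1 + b n * w ^ 2)

/-- **The cofactor** `Q(w) = H_t(0) (−(w + z₁)/z₁²)^m ∏_{n ∉ S₁} (1 + b_n w²)`, for which
`H_t(w) = (w − z₁)^m Q(w)`, `m = #S₁`. [cite: Polymath2019, §3] -/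
def cofactor (h : IsHadamardSeq t b) (z₁ w : ℂ) : ℂ :=
  deBruijnH t 0 * (-(w + z₁) / z₁ ^ 2) ^ (h.zeroIndices z₁).card * h.tailProd z₁ w

/-- The multiplicity `m = #{n : 1 + b_n z₁² = 0}`. [cite: Polymath2019, §3] -/
def mult (h : IsHadamardSeq t b) (z₁ : ℂ) : ℕ := (h.zeroIndices z₁).card

/-- The norms of the tail subfamily are summable. [folklore] -/
theorem summable_tail (h : IsHadamardSeq t b) (z₁ : ℂ) :
    Summable fun n : ↥((h.zeroIndices z₁ : Set ℕ)ᶜ) ↦ ‖b n‖ :=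
  h.summable.subtype _

/-- The tail product converges. [folklore] -/
theorem hasProd_tail (h : IsHadamardSeq t b) (z₁ w : ℂ) :
    HasProd (fun n : ↥((h.zeroIndices z₁ : Set ℕ)ᶜ) ↦ 1 + b n * w ^ 2) (h.tailProd z₁ w) := by
  have hm := (multipliableLocallyUniformlyOn_one_add_mul_sq (h.summable_tail z₁)
    (‖w‖ + 1)).multipliable (x := w) (by simp)
  exact hm.hasProd

/-- For `n ∈ S₁`: `1 + b_n w² = (w − z₁) · (−(w + z₁)/z₁²)` (as `b_n = −1/z₁²`). [folklore] -/
theorem factor_eq_of_mem (h : IsHadamardSeq t b) {z₁ : ℂ} (hz : z₁ ≠ 0) {n : ℕ}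
    (hn : n ∈ h.zeroIndices z₁) (w : ℂ) :
    1 + b n * w ^ 2 = (w - z₁) * (-(w + z₁) / z₁ ^ 2) := by
  rw [mem_zeroIndices] at hn
  have hb : b n = -1 / z₁ ^ 2 := by
    field_simp
    linear_combination hn
  rw [hb]
  field_simp
  ring

/-- **Factorisation at a zero**: `H_t(w) = (w − z₁)^m Q(w)` for all `w`. [cite: Polymath2019, §3] -/
theorem eq_pow_mul_cofactor (h : IsHadamardSeq t b) {z₁ : ℂ} (hz₁ : deBruijnH t z₁ = 0) (w : ℂ) :
    deBruijnH t w = (w - z₁) ^ h.mult z₁ * h.cofactor z₁ w := by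
  have hz := ne_zero_of_deBruijnH_eq_zero hz₁
  have hfin : ∏ n ∈ h.zeroIndices z₁, (1 + b n * w ^ 2) =
      (w - z₁) ^ h.mult z₁ * (-(w + z₁) / z₁ ^ 2) ^ h.mult z₁ := by
    simp only [mult]
    rw [Finset.prod_congr rfl fun n hn ↦ h.factor_eq_of_mem hz hn w, Finset.prod_const, mul_pow]
  have h1 : HasProd (fun n ↦ 1 + b n * w ^ 2)
      (h.tailProd z₁ w * ∏ n ∈ h.zeroIndices z₁, (1 + b n * w ^ 2)) := by
    have hA := (hasProd_subtype_iff_mulIndicator (f := fun n ↦ 1 + b n * w ^ 2)).1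
      (h.hasProd_tail z₁ w)
    have hB := (hasProd_subtype_iff_mulIndicator (f := fun n ↦ 1 + b n * w ^ 2)).1
      (Finset.hasProd (h.zeroIndices z₁) fun n ↦ 1 + b n * w ^ 2)
    have e : (fun n ↦ ((h.zeroIndices z₁ : Set ℕ))ᶜ.mulIndicator (fun n ↦ 1 + b n * w ^ 2) n *
        ((h.zeroIndices z₁ : Set ℕ)).mulIndicator (fun n ↦ 1 + b n * w ^ 2) n) =
        fun n ↦ 1 + b n * w ^ 2 :=
      Set.mulIndicator_compl_mul_self _ _
    have := hA.mul hB
    rwa [e] at this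
  have h2 : deBruijnH t w / deBruijnH t 0 =
      h.tailProd z₁ w * ∏ n ∈ h.zeroIndices z₁, (1 + b n * w ^ 2) :=
    (h.hasProd w).unique h1
  have h3 : deBruijnH t w = deBruijnH t 0 * (deBruijnH t w / deBruijnH t 0) := by
    rw [mul_comm, div_mul_cancel₀ _ (deBruijnH_apply_zero_ne_zero t)]
  rw [h3, h2, hfin, cofactor, mult]
  ring

/-- The tail product does not vanish at `z₁`. [folklore] -/
theorem tailProd_self_ne_zero (h : IsHadamardSeq t b) (z₁ : ℂ) : h.tailProd z₁ z₁ ≠ 0 :=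
  tprod_one_add_mul_sq_ne_zero (h.summable_tail z₁) fun n ↦ by
    have hn : (n : ℕ) ∉ h.zeroIndices z₁ := fun hm ↦ n.2 (Finset.mem_coe.2 hm)
    rwa [mem_zeroIndices] at hn

/-- `Q(z₁) ≠ 0`. [cite: Polymath2019, §3] -/
theorem cofactor_self_ne_zero (h : IsHadamardSeq t b) {z₁ : ℂ} (hz₁ : deBruijnH t z₁ = 0) :
    h.cofactor z₁ z₁ ≠ 0 := by
  have hz := ne_zero_of_deBruijnH_eq_zero hz₁
  refine mul_ne_zero (mul_ne_zero (deBruijnH_apply_zero_ne_zero t) (pow_ne_zero _ ?_))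
    (h.tailProd_self_ne_zero z₁)
  have : -(z₁ + z₁) / z₁ ^ 2 = -2 / z₁ := by field_simp; ring
  rw [this]
  exact div_ne_zero (by norm_num) hz

/-- The tail product is entire. [folklore] -/
theorem differentiable_tailProd (h : IsHadamardSeq t b) (z₁ : ℂ) :
    Differentiable ℂ (h.tailProd z₁) :=
  differentiable_tprod_one_add_mul_sq (h.summable_tail z₁)

/-- The cofactor is entire. [folklore] -/
theorem differentiable_cofactor (h : IsHadamardSeq t b) (z₁ : ℂ) :
    Differentiable ℂ (h.cofactor z₁) := by
  unfold cofactor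
  have hp : Differentiable ℂ fun w : ℂ ↦ (-(w + z₁) / z₁ ^ 2) ^ (h.zeroIndices z₁).card := by
    fun_prop
  exact ((differentiable_const _).mul hp).mul (h.differentiable_tailProd z₁)

/-- The multiplicity is the analytic order: `analyticOrderAt H_t z₁ = m`.
[cite: Polymath2019, §3] -/
theorem analyticOrderAt_eq_mult (h : IsHadamardSeq t b) {z₁ : ℂ} (hz₁ : deBruijnH t z₁ = 0) :
    analyticOrderAt (deBruijnH t) z₁ = h.mult z₁ := by
  rw [((differentiable_deBruijnH_holds t).analyticAt z₁).analyticOrderAt_eq_natCast]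
  exact ⟨h.cofactor z₁, (h.differentiable_cofactor z₁).analyticAt z₁, h.cofactor_self_ne_zero hz₁,
    Eventually.of_forall fun w ↦ by rw [smul_eq_mul]; exact h.eq_pow_mul_cofactor hz₁ w⟩

/-- A zero has positive multiplicity. [folklore] -/
theorem mult_pos (h : IsHadamardSeq t b) {z₁ : ℂ} (hz₁ : deBruijnH t z₁ = 0) : 0 < h.mult z₁ := by
  by_contra h0
  have hm : h.mult z₁ = 0 := by omega
  have := h.eq_pow_mul_cofactor hz₁ z₁
  rw [hz₁, hm, pow_zero, one_mul] at this
  exact h.cofactor_self_ne_zero hz₁ this.symm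

/-- `logDeriv` of the tail product at `z₁`. [folklore] -/
theorem logDeriv_tailProd_self (h : IsHadamardSeq t b) (z₁ : ℂ) :
    logDeriv (h.tailProd z₁) z₁ =
      ∑' n : ↥((h.zeroIndices z₁ : Set ℕ)ᶜ), 2 * b n * z₁ / (1 + b n * z₁ ^ 2) :=
  logDeriv_tprod_one_add_mul_sq (h.summable_tail z₁) fun n ↦ by
    have hn : (n : ℕ) ∉ h.zeroIndices z₁ := fun hm ↦ n.2 (Finset.mem_coe.2 hm)
    rwa [mem_zeroIndices] at hn

/-- The tail sum equals the full sum: the omitted terms are `2 b_n z₁ / 0 = 0`. [folklore] -/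
theorem tsum_tail_eq (h : IsHadamardSeq t b) (z₁ : ℂ) :
    ∑' n : ↥((h.zeroIndices z₁ : Set ℕ)ᶜ), 2 * b n * z₁ / (1 + b n * z₁ ^ 2) =
      ∑' n : ℕ, 2 * b n * z₁ / (1 + b n * z₁ ^ 2) := by
  refine tsum_subtype_eq_of_support_subset (f := fun n : ℕ ↦ 2 * b n * z₁ / (1 + b n * z₁ ^ 2))
    (s := ((h.zeroIndices z₁ : Set ℕ)ᶜ)) fun n hn ↦ ?_
  rw [Set.mem_compl_iff, Finset.mem_coe, mem_zeroIndices]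
  intro h0
  apply hn
  simp [h0]

/-- **The regularised logarithmic derivative at a zero**:
`Q'(z₁)/Q(z₁) = m/(2z₁) + ∑_n 2 b_n z₁/(1 + b_n z₁²)` (the `m` terms with `1 + b_n z₁² = 0`, which
in the series for `H_t'/H_t` are the poles `1/(w − z₁) + 1/(w + z₁)`, contribute `0` to the sum in
Lean's convention and `m/(2z₁)` through the cofactor). [cite: Polymath2019, §3] -/
theorem logDeriv_cofactor_self (h : IsHadamardSeq t b) {z₁ : ℂ} (hz₁ : deBruijnH t z₁ = 0) :
    logDeriv (h.cofactor z₁) z₁ =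
      h.mult z₁ / (2 * z₁) + ∑' n : ℕ, 2 * b n * z₁ / (1 + b n * z₁ ^ 2) := by
  have hz := ne_zero_of_deBruijnH_eq_zero hz₁
  have hp0 : (-(z₁ + z₁) / z₁ ^ 2) = -2 / z₁ := by field_simp; ring
  have hpne : (-(z₁ + z₁) / z₁ ^ 2) ≠ 0 := by rw [hp0]; exact div_ne_zero (by norm_num) hz
  -- logDeriv of the polynomial part
  have hd : HasDerivAt (fun w : ℂ ↦ -(w + z₁) / z₁ ^ 2) (-1 / z₁ ^ 2) z₁ := by
    have := ((hasDerivAt_id z₁).add_const z₁).neg.div_const (z₁ ^ 2)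
    simpa using this
  have hP : logDeriv (fun w : ℂ ↦ deBruijnH t 0 * (-(w + z₁) / z₁ ^ 2) ^ (h.zeroIndices z₁).card) z₁
      = h.mult z₁ / (2 * z₁) := by
    rw [logDeriv_const_mul (f := fun w : ℂ ↦ (-(w + z₁) / z₁ ^ 2) ^ (h.zeroIndices z₁).card) z₁ _
        (deBruijnH_apply_zero_ne_zero t),
      logDeriv_fun_pow (f := fun w : ℂ ↦ -(w + z₁) / z₁ ^ 2) hd.differentiableAt, logDeriv_apply,
      hd.deriv, hp0, mult]
    field_simp
  unfold cofactor
  rw [logDeriv_mul (f := fun w : ℂ ↦ deBruijnH t 0 * (-(w + z₁) / z₁ ^ 2) ^ (h.zeroIndices z₁).card)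
      (g := h.tailProd z₁) z₁
      (mul_ne_zero (deBruijnH_apply_zero_ne_zero t) (pow_ne_zero _ hpne))
      (h.tailProd_self_ne_zero z₁) (by fun_prop) (h.differentiable_tailProd z₁ z₁),
    hP, h.logDeriv_tailProd_self, h.tsum_tail_eq]

end IsHadamardSeq

/-! ## Uniqueness of the regularised logarithmic derivative and of the multiplicity -/

/-- Two local cofactors of the same function at `z₁` (same exponent) agree near `z₁`. [folklore] -/
theorem cofactor_eventuallyEq {H Q₁ Q₂ : ℂ → ℂ} {z₁ : ℂ} {m : ℕ}
    (h₁ : ∀ᶠ w in 𝓝 z₁, H w = (w - z₁) ^ m * Q₁ w) (h₂ : ∀ᶠ w in 𝓝 z₁, H w = (w - z₁) ^ m * Q₂ w)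
    (hc₁ : ContinuousAt Q₁ z₁) (hc₂ : ContinuousAt Q₂ z₁) : Q₁ =ᶠ[𝓝 z₁] Q₂ := by
  -- off `z₁` one may cancel `(w - z₁)^m`
  have hp : ∀ᶠ w in 𝓝[≠] z₁, Q₁ w = Q₂ w := by
    have h12 : ∀ᶠ w in 𝓝[≠] z₁, H w = (w - z₁) ^ m * Q₁ w ∧ H w = (w - z₁) ^ m * Q₂ w :=
      eventually_nhdsWithin_of_eventually_nhds (h₁.and h₂)
    filter_upwards [h12, self_mem_nhdsWithin] with w hw hne
    have hwz : (w - z₁) ^ m ≠ 0 := pow_ne_zero _ (sub_ne_zero.2 hne)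
    exact mul_left_cancel₀ hwz (hw.1.symm.trans hw.2)
  -- at `z₁` by continuity
  have h0 : Q₁ z₁ = Q₂ z₁ :=
    tendsto_nhds_unique_of_eventuallyEq (hc₁.tendsto.mono_left nhdsWithin_le_nhds)
      (hc₂.tendsto.mono_left nhdsWithin_le_nhds) hp
  rw [eventually_nhdsWithin_iff] at hp
  filter_upwards [hp] with w hw
  rcases eq_or_ne w z₁ with rfl | hne
  · exact h0
  · exact hw hne

/-- Hence the regularised logarithmic derivative `Q'(z₁)/Q(z₁)` does not depend on the cofactor.
[folklore] -/
theorem logDeriv_cofactor_unique {H Q₁ Q₂ : ℂ → ℂ} {z₁ : ℂ} {m : ℕ}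
    (h₁ : ∀ᶠ w in 𝓝 z₁, H w = (w - z₁) ^ m * Q₁ w) (h₂ : ∀ᶠ w in 𝓝 z₁, H w = (w - z₁) ^ m * Q₂ w)
    (hc₁ : ContinuousAt Q₁ z₁) (hc₂ : ContinuousAt Q₂ z₁) : logDeriv Q₁ z₁ = logDeriv Q₂ z₁ := by
  have he := cofactor_eventuallyEq h₁ h₂ hc₁ hc₂
  rw [logDeriv_apply, logDeriv_apply, he.deriv_eq, he.eq_of_nhds]

namespace IsHadamardSeq

variable {t : ℝ} {b : ℕ → ℂ}

/-- The multiplicity of a local factorisation `H_t = (w − z₁)^m Q`, `Q(z₁) ≠ 0`, is `mult`.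
[folklore] -/
theorem mult_eq_of_eventually (h : IsHadamardSeq t b) {z₁ : ℂ} (hz₁ : deBruijnH t z₁ = 0) {m : ℕ}
    {Q : ℂ → ℂ} (hQa : AnalyticAt ℂ Q z₁) (hQ0 : Q z₁ ≠ 0)
    (hfac : ∀ᶠ w in 𝓝 z₁, deBruijnH t w = (w - z₁) ^ m * Q w) : h.mult z₁ = m := by
  have h1 : analyticOrderAt (deBruijnH t) z₁ = m := by
    rw [((differentiable_deBruijnH_holds t).analyticAt z₁).analyticOrderAt_eq_natCast]
    exact ⟨Q, hQa, hQ0, hfac.mono fun w hw ↦ by rw [smul_eq_mul]; exact hw⟩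
  rw [h.analyticOrderAt_eq_mult hz₁] at h1
  exact_mod_cast h1

/-- The regularised logarithmic derivative of any local cofactor is that of `cofactor`.
[folklore] -/
theorem logDeriv_eq_logDeriv_cofactor (h : IsHadamardSeq t b) {z₁ : ℂ} (hz₁ : deBruijnH t z₁ = 0)
    {m : ℕ} {Q : ℂ → ℂ} (hQa : AnalyticAt ℂ Q z₁) (hQ0 : Q z₁ ≠ 0)
    (hfac : ∀ᶠ w in 𝓝 z₁, deBruijnH t w = (w - z₁) ^ m * Q w) :
    logDeriv Q z₁ = logDeriv (h.cofactor z₁) z₁ := by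
  have hm := h.mult_eq_of_eventually hz₁ hQa hQ0 hfac
  refine logDeriv_cofactor_unique (H := deBruijnH t) (m := m) hfac ?_ hQa.continuousAt
    ((h.differentiable_cofactor z₁).continuous.continuousAt)
  exact Eventually.of_forall fun w ↦ by rw [← hm]; exact h.eq_pow_mul_cofactor hz₁ w

end IsHadamardSeq

/-! ## The sign computation -/

/-- Partial fractions: if `b ζ² = −1` and `1 + b z² ≠ 0` then
`2bz/(1 + bz²) = 1/(z − ζ) + 1/(z + ζ)`. [cite: Polymath2019, §3] -/
theorem term_eq_inv_add_inv {c ζ z : ℂ} (hζ : c * ζ ^ 2 = -1) (hz : 1 + c * z ^ 2 ≠ 0) :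
    2 * c * z / (1 + c * z ^ 2) = (z - ζ)⁻¹ + (z + ζ)⁻¹ := by
  have h1 : z - ζ ≠ 0 := by
    intro h0
    have : z = ζ := sub_eq_zero.1 h0
    apply hz
    rw [this]
    linear_combination hζ
  have h2 : z + ζ ≠ 0 := by
    intro h0
    have : z = -ζ := by linear_combination h0
    apply hz
    rw [this]
    linear_combination hζ
  have hc : c ≠ 0 := by
    rintro rfl
    norm_num at hζ
  have hden : 1 + c * z ^ 2 = c * (z - ζ) * (z + ζ) := by linear_combination hζ
  rw [hden] at hz ⊢
  field_simp
  ring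

/-- `Im (1/w) = −Im w/(Re w² + Im w²)` (Mathlib's `Complex.inv_im` with `normSq` unfolded).
[folklore] -/
private theorem inv_im_eq (w : ℂ) : (w⁻¹).im = -w.im / (w.re ^ 2 + w.im ^ 2) := by
  rw [Complex.inv_im, Complex.normSq_apply]
  ring

/-- The elementary inequality behind the pairing of a zero with its conjugate
(Polymath 15, end of the proof of Prop. 3.3: "this inequality eventually simplifies to
`y_k² ≤ (x − x_k)² + Y²`"): for `Y > 0` and `y² ≤ u² + Y²`,
`−(Y − y)/(u² + (Y − y)²) − (Y + y)/(u² + (Y + y)²) ≤ 0`. [cite: Polymath2019, Prop. 3.3 (proof)] -/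
theorem pair_im_le {u y Y : ℝ} (hY : 0 < Y) (h : y ^ 2 ≤ u ^ 2 + Y ^ 2) :
    -(Y - y) / (u ^ 2 + (Y - y) ^ 2) + -(Y + y) / (u ^ 2 + (Y + y) ^ 2) ≤ 0 := by
  rcases eq_or_ne (u ^ 2 + (Y - y) ^ 2) 0 with h1 | h1
  · have hu : u = 0 := by nlinarith [sq_nonneg u, sq_nonneg (Y - y)]
    have hy : y = Y := by nlinarith [sq_nonneg u, sq_nonneg (Y - y)]
    rw [h1, div_zero, zero_add, hu, hy]
    apply div_nonpos_of_nonpos_of_nonneg <;> nlinarith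
  rcases eq_or_ne (u ^ 2 + (Y + y) ^ 2) 0 with h2 | h2
  · have hu : u = 0 := by nlinarith [sq_nonneg u, sq_nonneg (Y + y)]
    have hy : y = -Y := by nlinarith [sq_nonneg u, sq_nonneg (Y + y)]
    rw [h2, div_zero, add_zero, hu, hy]
    apply div_nonpos_of_nonpos_of_nonneg <;> nlinarith
  have hn1 : 0 < u ^ 2 + (Y - y) ^ 2 := lt_of_le_of_ne (by positivity) (Ne.symm h1)
  have hn2 : 0 < u ^ 2 + (Y + y) ^ 2 := lt_of_le_of_ne (by positivity) (Ne.symm h2)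
  have e : -(Y - y) / (u ^ 2 + (Y - y) ^ 2) + -(Y + y) / (u ^ 2 + (Y + y) ^ 2) =
      (-2 * Y * (u ^ 2 + Y ^ 2 - y ^ 2)) / ((u ^ 2 + (Y - y) ^ 2) * (u ^ 2 + (Y + y) ^ 2)) := by
    field_simp
    ring
  rw [e]
  apply div_nonpos_of_nonpos_of_nonneg
  · nlinarith
  · positivity

/-- **The four terms of a zero `ζ`, its negative and their conjugates**: for `z₁ = x + iY`, `Y > 0`,
and `ζ` with `Im ζ² ≤ (x − Re ζ)² + Y²`, `Im ζ² ≤ (x + Re ζ)² + Y²`,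
`Im [1/(z₁ − ζ) + 1/(z₁ + ζ) + 1/(z₁ − ζ̄) + 1/(z₁ + ζ̄)] ≤ 0`.
[cite: Polymath2019, Prop. 3.3 (proof)] -/
theorem four_terms_im_le {z₁ ζ : ℂ} (hY : 0 < z₁.im)
    (h₁ : ζ.im ^ 2 ≤ (z₁.re - ζ.re) ^ 2 + z₁.im ^ 2)
    (h₂ : ζ.im ^ 2 ≤ (z₁.re + ζ.re) ^ 2 + z₁.im ^ 2) :
    ((z₁ - ζ)⁻¹ + (z₁ + ζ)⁻¹ + ((z₁ - starRingEnd ℂ ζ)⁻¹ + (z₁ + starRingEnd ℂ ζ)⁻¹)).im ≤ 0 := by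
  have e : ((z₁ - ζ)⁻¹ + (z₁ + ζ)⁻¹ + ((z₁ - starRingEnd ℂ ζ)⁻¹ + (z₁ + starRingEnd ℂ ζ)⁻¹)).im =
      (-(z₁.im - ζ.im) / ((z₁.re - ζ.re) ^ 2 + (z₁.im - ζ.im) ^ 2) +
        -(z₁.im + ζ.im) / ((z₁.re - ζ.re) ^ 2 + (z₁.im + ζ.im) ^ 2)) +
      (-(z₁.im - ζ.im) / ((z₁.re + ζ.re) ^ 2 + (z₁.im - ζ.im) ^ 2) +
        -(z₁.im + ζ.im) / ((z₁.re + ζ.re) ^ 2 + (z₁.im + ζ.im) ^ 2)) := by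
    simp only [Complex.add_im, inv_im_eq, Complex.sub_re, Complex.sub_im, Complex.add_re,
      Complex.conj_re, Complex.conj_im]
    ring
  rw [e]
  exact add_nonpos (pair_im_le hY h₁) (pair_im_le hY h₂)

/-- The special terms: for `z₁ = x + iY` with `Y ≠ 0`,
`Im [1/(z₁ − z̄₁) + 1/(z₁ + z̄₁)] = −1/(2Y)`
("the contribution of the zero `x − iY(t₁)` is `−1/Y(t₁)`; the contribution of the zero
`−x + iY(t₁)` vanishes"). [cite: Polymath2019, Prop. 3.3 (proof)] -/
theorem conj_terms_im {z₁ : ℂ} (hY : z₁.im ≠ 0) :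
    ((z₁ - starRingEnd ℂ z₁)⁻¹ + (z₁ + starRingEnd ℂ z₁)⁻¹).im = -1 / (2 * z₁.im) := by
  rw [Complex.add_im, inv_im_eq, inv_im_eq]
  simp only [Complex.sub_re, Complex.sub_im, Complex.add_re, Complex.add_im, Complex.conj_re,
    Complex.conj_im, sub_self, sub_neg_eq_add, add_neg_cancel]
  have h2 : (z₁.im + z₁.im) ≠ 0 := by
    intro h0; apply hY; linarith
  field_simp
  ring

/-- **The sign computation** (Polymath 15, proof of Prop. 3.3, for a zero of any multiplicity).
Let `z₁ = x + iY` with `x, Y > 0` be a zero of `H_t` of multiplicity `m`, and suppose every zero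
`ρ` of `H_t` satisfies `|Im ρ| < 1` and, if `|Im ρ| > Y`, `(x − Re ρ)² ≥ 1 − Y²` (hence also
`(x + Re ρ)² ≥ 1 − Y²`, `H_t` being even). Then for every local cofactor `Q` (`H_t = (w − z₁)^m Q` near `z₁`,
`Q(z₁) ≠ 0`, `Q` analytic at `z₁`): `Im (Q'/Q)(z₁) < −m/(2Y)`. Proof: average the two expansions
`Q'/Q(z₁) = m/(2z₁) + ∑ T_n` for `b` and `conj ∘ b` (`logDeriv_cofactor_self`); the `2m` indices
with `1 + b_n z₁² = 0` or `1 + conj(b_n) z₁² = 0` contribute `Im = −1/(2Y)` each (`conj_terms_im`),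
all others `Im (T_n + T*_n) ≤ 0` (`four_terms_im_le`), and `Im (m/z₁) < 0`.
[cite: Polymath2019, Prop. 3.3 (proof)] -/
theorem im_logDeriv_cofactor_lt {t : ℝ} {z₁ : ℂ} (hx : 0 < z₁.re) (hY : 0 < z₁.im)
    (hz₁ : deBruijnH t z₁ = 0)
    (hstrip : ∀ ρ : ℂ, deBruijnH t ρ = 0 → |ρ.im| < 1)
    (hfar₁ : ∀ ρ : ℂ, deBruijnH t ρ = 0 → z₁.im < |ρ.im| → 1 - z₁.im ^ 2 ≤ (z₁.re - ρ.re) ^ 2)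
    {m : ℕ} {Q : ℂ → ℂ} (hQa : AnalyticAt ℂ Q z₁) (hQ0 : Q z₁ ≠ 0)
    (hfac : ∀ᶠ w in 𝓝 z₁, deBruijnH t w = (w - z₁) ^ m * Q w) :
    (logDeriv Q z₁).im < -m / (2 * z₁.im) := by
  -- by evenness of `H_t` the hypothesis also controls `(x + Re ρ)²`
  have hfar : ∀ ρ : ℂ, deBruijnH t ρ = 0 → z₁.im < |ρ.im| →
      1 - z₁.im ^ 2 ≤ (z₁.re - ρ.re) ^ 2 ∧ 1 - z₁.im ^ 2 ≤ (z₁.re + ρ.re) ^ 2 := fun ρ hρ hlt ↦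
    ⟨hfar₁ ρ hρ hlt, by
      have := hfar₁ (-ρ) (by rw [deBruijnH_neg]; exact hρ) (by simpa using hlt)
      simpa using this⟩
  obtain ⟨b, hb⟩ := exists_isHadamardSeq t
  have hb' := hb.conj
  -- multiplicities and the two expansions
  have hm : hb.mult z₁ = m := hb.mult_eq_of_eventually hz₁ hQa hQ0 hfac
  have hm' : hb'.mult z₁ = m := hb'.mult_eq_of_eventually hz₁ hQa hQ0 hfac
  have hL : logDeriv Q z₁ = m / (2 * z₁) + ∑' n : ℕ, 2 * b n * z₁ / (1 + b n * z₁ ^ 2) := by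
    rw [hb.logDeriv_eq_logDeriv_cofactor hz₁ hQa hQ0 hfac, hb.logDeriv_cofactor_self hz₁, hm]
  have hL' : logDeriv Q z₁ = m / (2 * z₁) +
      ∑' n : ℕ, 2 * starRingEnd ℂ (b n) * z₁ / (1 + starRingEnd ℂ (b n) * z₁ ^ 2) := by
    rw [hb'.logDeriv_eq_logDeriv_cofactor hz₁ hQa hQ0 hfac, hb'.logDeriv_cofactor_self hz₁, hm']
  set T : ℕ → ℂ := fun n ↦ 2 * b n * z₁ / (1 + b n * z₁ ^ 2) with hT
  set T' : ℕ → ℂ := fun n ↦ 2 * starRingEnd ℂ (b n) * z₁ / (1 + starRingEnd ℂ (b n) * z₁ ^ 2)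
    with hT'
  have hsT : Summable T := summable_logDeriv_terms hb.summable z₁
  have hsT' : Summable T' := summable_logDeriv_terms hb'.summable z₁
  have h2L : 2 * logDeriv Q z₁ = m / z₁ + ∑' n, (T n + T' n) := by
    rw [hsT.tsum_add hsT', two_mul]
    nth_rewrite 1 [hL]
    rw [hL']
    have hz : z₁ ≠ 0 := ne_zero_of_deBruijnH_eq_zero hz₁
    field_simp
    ring
  -- the index sets of the special terms
  set S₁ := hb.zeroIndices z₁ with hS₁
  set S₂ := hb'.zeroIndices z₁ with hS₂
  have hz0 : z₁ ≠ 0 := ne_zero_of_deBruijnH_eq_zero hz₁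
  have hzsq : starRingEnd ℂ z₁ ^ 2 ≠ z₁ ^ 2 := by
    intro h0
    have : (starRingEnd ℂ z₁ - z₁) * (starRingEnd ℂ z₁ + z₁) = 0 := by ring_nf; rw [h0]; ring
    rcases mul_eq_zero.1 this with h1 | h1
    · have := congrArg Complex.im h1
      simp at this
      linarith
    · have := congrArg Complex.re h1
      simp at this
      linarith
  have hdisj : Disjoint S₁ S₂ := by
    rw [Finset.disjoint_left]
    intro n h1 h2
    rw [hS₁, hb.mem_zeroIndices] at h1
    rw [hS₂, hb'.mem_zeroIndices] at h2
    -- `b z₁² = -1 = conj b z₁²` forces `b = conj b` and then `z₁²` real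
    have e1 : b n * z₁ ^ 2 = -1 := by linear_combination h1
    have e2 : starRingEnd ℂ (b n) * z₁ ^ 2 = -1 := by linear_combination h2
    have hbn : b n ≠ 0 := by rintro h0; rw [h0] at e1; norm_num at e1
    have e3 : starRingEnd ℂ (b n) * starRingEnd ℂ z₁ ^ 2 = -1 := by
      have := congrArg (starRingEnd ℂ) e1
      simpa using this
    have : starRingEnd ℂ z₁ ^ 2 = z₁ ^ 2 := by
      have hc : starRingEnd ℂ (b n) ≠ 0 := by simpa using hbn
      exact mul_left_cancel₀ hc (e3.trans e2.symm)
    exact hzsq this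
  have hcard₁ : S₁.card = m := hm
  have hcard₂ : S₂.card = m := hm'
  -- the values of the special terms
  have c₀_im : ((z₁ - starRingEnd ℂ z₁)⁻¹ + (z₁ + starRingEnd ℂ z₁)⁻¹).im = -1 / (2 * z₁.im) :=
    conj_terms_im hY.ne'
  have hspec₁ : ∀ n ∈ S₁, T n + T' n = (z₁ - starRingEnd ℂ z₁)⁻¹ + (z₁ + starRingEnd ℂ z₁)⁻¹ := by
    intro n hn
    have hn2 : n ∉ S₂ := Finset.disjoint_left.1 hdisj hn
    rw [hS₁, hb.mem_zeroIndices] at hn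
    rw [hS₂, hb'.mem_zeroIndices] at hn2
    have hT0 : T n = 0 := by simp only [hT, hn, div_zero]
    have e1 : b n * z₁ ^ 2 = -1 := by linear_combination hn
    have key : starRingEnd ℂ (b n) * starRingEnd ℂ z₁ ^ 2 = -1 := by
      have := congrArg (starRingEnd ℂ) e1
      simpa using this
    rw [hT0, zero_add, hT']
    exact term_eq_inv_add_inv key hn2
  have hspec₂ : ∀ n ∈ S₂, T n + T' n = (z₁ - starRingEnd ℂ z₁)⁻¹ + (z₁ + starRingEnd ℂ z₁)⁻¹ := by
    intro n hn
    have hn1 : n ∉ S₁ := Finset.disjoint_right.1 hdisj hn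
    rw [hS₂, hb'.mem_zeroIndices] at hn
    rw [hS₁, hb.mem_zeroIndices] at hn1
    have hT0 : T' n = 0 := by simp only [hT', hn, div_zero]
    have e1 : starRingEnd ℂ (b n) * z₁ ^ 2 = -1 := by linear_combination hn
    have key : b n * starRingEnd ℂ z₁ ^ 2 = -1 := by
      have := congrArg (starRingEnd ℂ) e1
      simpa using this
    rw [hT0, add_zero, hT]
    exact term_eq_inv_add_inv key hn1
  -- the generic terms
  have hgen : ∀ n, n ∉ S₁ → n ∉ S₂ → (T n + T' n).im ≤ 0 := by
    intro n hn1 hn2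
    rw [hS₁, hb.mem_zeroIndices] at hn1
    rw [hS₂, hb'.mem_zeroIndices] at hn2
    rcases eq_or_ne (b n) 0 with h0 | h0
    · simp [hT, hT', h0]
    · obtain ⟨ζ, hζ⟩ := IsAlgClosed.exists_pow_nat_eq (-(b n)⁻¹) two_pos
      have hbζ : b n * ζ ^ 2 = -1 := by rw [hζ]; field_simp
      have hbζ' : starRingEnd ℂ (b n) * starRingEnd ℂ ζ ^ 2 = -1 := by
        have := congrArg (starRingEnd ℂ) hbζ
        simpa using this
      have hζzero : deBruijnH t ζ = 0 := hb.eq_zero_of_factor (n := n) (by rw [hbζ]; ring)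
      have hs := hstrip ζ hζzero
      have hgeom : ζ.im ^ 2 ≤ (z₁.re - ζ.re) ^ 2 + z₁.im ^ 2 ∧
          ζ.im ^ 2 ≤ (z₁.re + ζ.re) ^ 2 + z₁.im ^ 2 := by
        rcases le_or_gt |ζ.im| z₁.im with hle | hlt
        · have : ζ.im ^ 2 ≤ z₁.im ^ 2 := by
            rw [← sq_abs ζ.im]; exact pow_le_pow_left₀ (abs_nonneg _) hle 2
          constructor <;> nlinarith [sq_nonneg (z₁.re - ζ.re), sq_nonneg (z₁.re + ζ.re)]
        · obtain ⟨hf1, hf2⟩ := hfar ζ hζzero hlt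
          have : ζ.im ^ 2 < 1 := by
            rw [← sq_abs ζ.im]
            exact (sq_lt_one_iff₀ (abs_nonneg _)).2 hs
          constructor <;> linarith
      show (2 * b n * z₁ / (1 + b n * z₁ ^ 2) +
        2 * starRingEnd ℂ (b n) * z₁ / (1 + starRingEnd ℂ (b n) * z₁ ^ 2)).im ≤ 0
      rw [term_eq_inv_add_inv hbζ hn1, term_eq_inv_add_inv hbζ' hn2]
      exact four_terms_im_le hY hgeom.1 hgeom.2
  -- compare the series of imaginary parts with a finitely supported majorant
  set d : ℕ → ℝ := fun n ↦ if n ∈ S₁ ∪ S₂ then -1 / (2 * z₁.im) else 0 with hd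
  have hle : ∀ n, (T n + T' n).im ≤ d n := by
    intro n
    by_cases hn : n ∈ S₁ ∪ S₂
    · rw [hd]; simp only [hn, if_true]
      rcases Finset.mem_union.1 hn with h1 | h2
      · rw [hspec₁ n h1, c₀_im]
      · rw [hspec₂ n h2, c₀_im]
    · rw [hd]; simp only [hn, if_false]
      rw [Finset.mem_union, not_or] at hn
      exact hgen n hn.1 hn.2
  have hsum_im : HasSum (fun n ↦ (T n + T' n).im) (∑' n, (T n + T' n)).im :=
    ((Complex.hasSum_iff _ _).1 (hsT.add hsT').hasSum).2
  have hsum_d : HasSum d (∑ n ∈ S₁ ∪ S₂, d n) :=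
    hasSum_sum_of_ne_finset_zero fun n hn ↦ by rw [hd]; simp only [hn, if_false]
  have hd_sum : ∑ n ∈ S₁ ∪ S₂, d n = (2 * m : ℕ) * (-1 / (2 * z₁.im)) := by
    rw [Finset.sum_congr rfl fun n hn ↦ show d n = -1 / (2 * z₁.im) by rw [hd]; simp [hn],
      Finset.sum_const, Finset.card_union_of_disjoint hdisj, hcard₁, hcard₂, nsmul_eq_mul]
    push_cast
    ring
  have hbound : (∑' n, (T n + T' n)).im ≤ (2 * m : ℕ) * (-1 / (2 * z₁.im)) := by
    rw [← hd_sum]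
    exact hasSum_le hle hsum_im hsum_d
  -- the term `m/z₁`
  have hfirst : ((m : ℂ) / z₁).im = -(m * z₁.im) / (z₁.re ^ 2 + z₁.im ^ 2) := by
    rw [div_eq_mul_inv, Complex.mul_im, inv_im_eq, Complex.inv_re, Complex.normSq_apply]
    simp
    ring
  have hm0 : 0 < m := by rw [← hm]; exact hb.mult_pos hz₁
  have hfirst_neg : ((m : ℂ) / z₁).im < 0 := by
    rw [hfirst]
    apply div_neg_of_neg_of_pos
    · have : (0 : ℝ) < m := by exact_mod_cast hm0
      nlinarith
    · positivity
  -- conclusion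
  have htot : (2 * logDeriv Q z₁).im < -(m : ℝ) / z₁.im := by
    rw [h2L, Complex.add_im]
    have : ((2 * m : ℕ) : ℝ) * (-1 / (2 * z₁.im)) = -(m : ℝ) / z₁.im := by
      push_cast
      field_simp
    linarith
  have e2 : (2 * logDeriv Q z₁).im = 2 * (logDeriv Q z₁).im := by simp
  rw [e2] at htot
  have : (logDeriv Q z₁).im < -(m : ℝ) / z₁.im / 2 := by linarith
  calc (logDeriv Q z₁).im < -(m : ℝ) / z₁.im / 2 := this
    _ = -m / (2 * z₁.im) := by field_simp

end Literature.NumberTheory.LFunctions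

end
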